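import Summits.Ventures.LatticeQCDFlow.Scaling.FlowHubProposalLaw
import Summits.Ventures.LatticeQCDFlow.Scaling.ReplicaExchangeBareAcceptance

/-!
HONEST FRAMING: exact (Metropolis-corrected) sampling algorithms for lattice gauge theory; figures
of merit are autocorrelation/cost numbers at stated couplings and volumes; no continuum-physics
claim.

# HubAcceptanceLaw — THE MEASURED SWAP ACCEPTANCES CAP THE RATE, AND ONE-SIDED DOMINATION FLOORS THEM: FOR EVERY
# ENTRY `r = (i,l)` OF THE SWAP LIST LET `α_r = Σ_x min{π̃(x), π̃(x^{(r)})}` BE ITS STATIONARY ACCEPTANCE; THEN AN IDLE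
# COLD REPLICA `k` HAS `Gap ≤ t·Σ_{r ∋ k} α_r/(2m·μ_k(A)μ_k(Aᶜ))`, `α_r` IS THE TWO-LEVEL SUM
# `Σ_{u,v} min{μ_i(u)μ_l(v), μ_i(φ_r⁻¹v)μ_l(φ_r u)}`, AND ONE-SIDED TRANSPORTED DOMINATION `p·μ_l(φu) ≤ μ_i(u)` GIVES
# `α_r ≥ p` — THE `p` OF THE LINEAR LAW IS AN ACCEPTANCE RATE (lean-2 GEN-23, ours)

Venture-side (OURS).  Cell `lqcd-flow` (pub-lqcd), unit `pub-lqcd-lean-2-g23`, 2026-08-26.  Chapter K, file 9: the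
quantity practitioners report for an exchange scheme is the acceptance rate of each swap.  Setting of
`Scaling/HubProposalLaw` (K2): `P = t·ptGraphSwap μ e φ + (1−t)·prodKernel w M` on an edge list `e` with maps `φ_r`;
`x^{(r)} = edgeFlowSwap φ_r i_r l_r x`.  The STATIONARY ACCEPTANCE of entry `r` is `α_r = Σ_x min{π̃(x), π̃(x^{(r)})}`
(the probability, from `π̃`, that the `r`-swap is accepted when proposed); `Scaling/FlowSwapAcceptanceTwoSided` (F6)
bounded the two-level form below by `r²` under TWO-SIDED ratio control.

## What is proved

* §1 **`flowPair_acceptance_ge_oneSided`** (measure level) — ONE-SIDED transported domination `p·μ_b(φu) ≤ μ_a(u)`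
  already gives (any real `p`) `Σ_{u,v} min{μ_a(u)μ_b(v), μ_a(φ⁻¹v)μ_b(φu)} ≥ p` (F6 needed both sides for `r²`).
* §2 `tensorFun_edgeFlowSwap_mul` (the swapped weight), **`edgeAcceptance_eq_twoLevel`** — `α_r` IS the two-level
  sum of the laws `μ_{i_r}, μ_{l_r}` and the map `φ_r` (the other levels marginalise out).
* §3 **`ptGraph_dirichletForm_swap_le_acc`** — `𝓔_{GSw}(F) ≤ (2m)⁻¹Σ_r Σ_x min{π̃(x),π̃(x^{(r)})}(F(x) − F(x^{(r)}))²`;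
  **`acceptance_spectralGap_le`** — for a level `k` with `w_k·Q_k(A,Aᶜ) = 0`, `μ_k(A)μ_k(Aᶜ) > 0`, sector-preserving
  maps: **`Gap(P) ≤ t·(Σ_{r ∋ k} α_r)/(2m·μ_k(A)μ_k(Aᶜ))`** — K2's `deg(k)` weighted by the measured acceptances.
* §4 **`hubEdge_acceptance_ge`** — on a hub entry `(0, k+1)` with map `φ`, transported domination `p·μ_{k+1}(φu) ≤ μ_0(u)`
  gives `α_r ≥ p`: the constant of the one-sided linear law (`Scaling/OneSidedHubFloor`, K2, K4) is observable as a
  floor on every hub swap's acceptance rate, while the acceptances observed at a cold replica cap its relaxation rate.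

Reading (no numerics implied): logging the acceptance of each proposed pair is enough to bound a cold replica's
relaxation rate from above (`t/(2m)` times the summed acceptances of its entries, over its sector variance), and a
uniformly accepted hub (`α ≥ p` on every hub entry) is what one-sided domination delivers — but an AVERAGE acceptance
floor does not imply the pointwise domination the floor theorems use.  NOT CLAIMED: a gap floor from measured
acceptances alone; continuous spaces; anything measured.  Literature grade (cell rule): ELEMENTARY, NEW TYPING; nothing
cited as a fact; no new bib keys.
-/

noncomputable section

open Finset Function
open Literature.Probability.MarkovChains

namespace Summit.Ventures.LatticeQCDFlow.Scaling

variable {S : Type*} [Fintype S] [DecidableEq S]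

/-! ## §1 One-sided domination floors the two-level acceptance -/

omit [DecidableEq S] in
/-- **`Acc(φ) ≥ p` under ONE-SIDED transported domination** `p·μ_b(φu) ≤ μ_a(u)` (`μ_b ≥ 0` a probability vector;
any real `p`): `p ≤ Σ_{u,v} min{μ_a(u)μ_b(v), μ_a(φ⁻¹v)μ_b(φu)}`. [ours] -/
theorem flowPair_acceptance_ge_oneSided {μa μb : S → ℝ} (hμb : ∀ u, 0 ≤ μb u) (hμb1 : ∑ u, μb u = 1)
    (φ : Equiv.Perm S) {p : ℝ} (hdom : ∀ u, p * μb (φ u) ≤ μa u) :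
    p ≤ ∑ u, ∑ v, min (μa u * μb v) (μa (φ.symm v) * μb (φ u)) := by
  have hterm : ∀ u v, p * (μb (φ u) * μb v) ≤ min (μa u * μb v) (μa (φ.symm v) * μb (φ u)) := by
    intro u v
    refine le_min ?_ ?_
    · calc p * (μb (φ u) * μb v) = (p * μb (φ u)) * μb v := by ring
        _ ≤ μa u * μb v := mul_le_mul_of_nonneg_right (hdom u) (hμb v)
    · have h2 := hdom (φ.symm v)
      rw [Equiv.apply_symm_apply] at h2
      calc p * (μb (φ u) * μb v) = (p * μb v) * μb (φ u) := by ring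
        _ ≤ μa (φ.symm v) * μb (φ u) := mul_le_mul_of_nonneg_right h2 (hμb _)
  have hφsum : ∑ u, μb (φ u) = 1 := by rw [Equiv.sum_comp φ μb]; exact hμb1
  calc p = p * ((∑ u, μb (φ u)) * ∑ v, μb v) := by rw [hφsum, hμb1]; ring
    _ = ∑ u, ∑ v, p * (μb (φ u) * μb v) := by
        rw [Finset.sum_mul_sum, Finset.mul_sum]
        exact sum_congr rfl fun u _ => by rw [Finset.mul_sum]
    _ ≤ _ := sum_le_sum fun u _ => sum_le_sum fun v _ => hterm u v

/-! ## §2 The stationary acceptance of an entry is a two-level quantity -/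

variable {K m : ℕ} {μ : Fin (K + 1) → S → ℝ} {M : Fin (K + 1) → S → S → ℝ} {w : Fin (K + 1) → ℝ} {t : ℝ}
  {e : Fin m → Fin (K + 1) × Fin (K + 1)} {φ : Fin m → Equiv.Perm S}

omit [Fintype S] [DecidableEq S] in
/-- **The swapped weight on an edge with a map:** for `i ≠ l`,
`π̃(edgeFlowSwap φ i l x)·μ_i(x_i)μ_l(x_l) = π̃(x)·μ_i(φ⁻¹x_l)μ_l(φx_i)`. [ours] -/
theorem tensorFun_edgeFlowSwap_mul (μ : Fin (K + 1) → S → ℝ) (ψ : Equiv.Perm S) {i l : Fin (K + 1)} (hil : i ≠ l)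
    (x : Fin (K + 1) → S) :
    tensorFun μ (edgeFlowSwap ψ i l x) * (μ i (x i) * μ l (x l))
      = tensorFun μ x * (μ i (ψ.symm (x l)) * μ l (ψ (x i))) := by
  unfold tensorFun
  rw [prod_levels_split_two (fun k => μ k (edgeFlowSwap ψ i l x k)) hil,
    prod_levels_split_two (fun k => μ k (x k)) hil]
  have hrest : ∏ k ∈ (univ.erase i).erase l, μ k (edgeFlowSwap ψ i l x k)
      = ∏ k ∈ (univ.erase i).erase l, μ k (x k) := by
    refine prod_congr rfl fun k hk => ?_
    have h2 : k ≠ l := Finset.ne_of_mem_erase hk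
    have h1 : k ≠ i := Finset.ne_of_mem_erase (Finset.mem_of_mem_erase hk)
    rw [edgeFlowSwap_of_ne ψ i l x h1 h2]
  rw [hrest]
  simp only [edgeFlowSwap_fst ψ hil, edgeFlowSwap_snd]
  ring

/-- **THE STATIONARY ACCEPTANCE OF AN ENTRY IS THE TWO-LEVEL SUM:** for `i ≠ l`,
`Σ_x min{π̃(x), π̃(edgeFlowSwap φ i l x)} = Σ_{u,v} min{μ_i(u)μ_l(v), μ_i(φ⁻¹v)μ_l(φu)}`. [ours] -/
theorem edgeAcceptance_eq_twoLevel (hμ : ∀ k u, 0 < μ k u) (hμ1 : ∀ k, ∑ u, μ k u = 1) (ψ : Equiv.Perm S)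
    {i l : Fin (K + 1)} (hil : i ≠ l) :
    ∑ x : Fin (K + 1) → S, min (tensorFun μ x) (tensorFun μ (edgeFlowSwap ψ i l x))
      = ∑ u, ∑ v, min (μ i u * μ l v) (μ i (ψ.symm v) * μ l (ψ u)) := by
  have hmin : ∀ x : Fin (K + 1) → S, min (tensorFun μ x) (tensorFun μ (edgeFlowSwap ψ i l x))
      = tensorFun μ x * min 1 (μ i (ψ.symm (x l)) * μ l (ψ (x i)) / (μ i (x i) * μ l (x l))) := by
    intro x
    have hpos : 0 < μ i (x i) * μ l (x l) := mul_pos (hμ _ _) (hμ _ _)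
    have hsw : tensorFun μ (edgeFlowSwap ψ i l x)
        = tensorFun μ x * (μ i (ψ.symm (x l)) * μ l (ψ (x i)) / (μ i (x i) * μ l (x l))) := by
      rw [mul_div_assoc', eq_div_iff hpos.ne', tensorFun_edgeFlowSwap_mul μ ψ hil]
    rw [hsw, (monotone_mul_left_of_nonneg (tensorFun_pos hμ x).le).map_min, mul_one]
  simp_rw [hmin]
  rw [sum_tensorFun_mul_two_fun hμ1 hil (fun u v => min 1 (μ i (ψ.symm v) * μ l (ψ u) / (μ i u * μ l v)))]
  refine sum_congr rfl fun u _ => sum_congr rfl fun v _ => ?_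
  have hpos : 0 < μ i u * μ l v := mul_pos (hμ _ _) (hμ _ _)
  rw [(monotone_mul_left_of_nonneg hpos.le).map_min, mul_one, mul_div_cancel₀ _ hpos.ne']

/-! ## §3 The acceptance-weighted swap Dirichlet form and the refined replica ceiling -/

/-- **The graph-swap Dirichlet form with the acceptances kept:**
`𝓔_{GSw}(F) ≤ (2m)⁻¹·Σ_r Σ_x min{π̃(x), π̃(x^{(r)})}·(F(x) − F(x^{(r)}))²` (edges with distinct endpoints). [ours] -/
theorem ptGraph_dirichletForm_swap_le_acc (hμ : ∀ k x, 0 < μ k x) (he : ∀ r, (e r).1 ≠ (e r).2)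
    (F : (Fin (K + 1) → S) → ℝ) :
    dirichletForm (tensorFun μ) (ptGraphSwap μ e φ) F
      ≤ 1 / (2 * m) * ∑ r : Fin m, ∑ x : Fin (K + 1) → S,
          min (tensorFun μ x) (tensorFun μ (edgeFlowSwap (φ r) (e r).1 (e r).2 x))
            * (F x - F (edgeFlowSwap (φ r) (e r).1 (e r).2 x)) ^ 2 := by
  have hpt : ∀ x y : Fin (K + 1) → S, tensorFun μ x * ptGraphSwap μ e φ x y * (F x - F y) ^ 2
      ≤ ptGraphProposal e φ x y * (min (tensorFun μ x) (tensorFun μ y) * (F x - F y) ^ 2) := by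
    intro x y
    by_cases hyx : y = x
    · rw [hyx, sub_self]; simp
    · rw [← mul_assoc, tensorFun_mul_ptGraphSwap hμ he hyx]
  have hrow : ∀ (x : Fin (K + 1) → S) (c : (Fin (K + 1) → S) → ℝ),
      ∑ y, ptGraphProposal e φ x y * c y = ∑ r : Fin m, 1 / m * c (edgeFlowSwap (φ r) (e r).1 (e r).2 x) := by
    intro x c
    unfold ptGraphProposal
    simp_rw [Finset.sum_mul]
    rw [Finset.sum_comm]
    refine sum_congr rfl fun r _ => ?_
    simp_rw [ite_mul, zero_mul]
    rw [Finset.sum_ite_eq' univ (edgeFlowSwap (φ r) (e r).1 (e r).2 x), if_pos (mem_univ _)]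
  unfold dirichletForm
  calc 1 / 2 * ∑ x, ∑ y, tensorFun μ x * ptGraphSwap μ e φ x y * (F x - F y) ^ 2
      ≤ 1 / 2 * ∑ x, ∑ y, ptGraphProposal e φ x y * (min (tensorFun μ x) (tensorFun μ y) * (F x - F y) ^ 2) :=
        mul_le_mul_of_nonneg_left (sum_le_sum fun x _ => sum_le_sum fun y _ => hpt x y) (by norm_num)
    _ = 1 / 2 * ∑ x, ∑ r : Fin m, 1 / m * (min (tensorFun μ x) (tensorFun μ (edgeFlowSwap (φ r) (e r).1 (e r).2 x))
          * (F x - F (edgeFlowSwap (φ r) (e r).1 (e r).2 x)) ^ 2) := by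
        congr 1
        exact sum_congr rfl fun x _ => hrow x (fun y => min (tensorFun μ x) (tensorFun μ y) * (F x - F y) ^ 2)
    _ = 1 / (2 * m) * ∑ r : Fin m, ∑ x : Fin (K + 1) → S,
          min (tensorFun μ x) (tensorFun μ (edgeFlowSwap (φ r) (e r).1 (e r).2 x))
            * (F x - F (edgeFlowSwap (φ r) (e r).1 (e r).2 x)) ^ 2 := by
        rw [Finset.sum_comm]
        simp_rw [← Finset.mul_sum]
        rw [← mul_assoc]
        congr 1
        ring

/-- **THE MEASURED ACCEPTANCES OF A REPLICA'S ENTRIES CAP ITS RATE:** for a level `k` with `w_k·Q_k(A,Aᶜ) = 0`,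
`μ_k(A)μ_k(Aᶜ) > 0`, sector-preserving maps, `m ≥ 1`, `0 ≤ t ≤ 1`, `|S| ≥ 2`:
**`Gap(P) ≤ t·(Σ_{r : e_r ∋ k} α_r)/(2m·μ_k(A)μ_k(Aᶜ))`**, `α_r = Σ_x min{π̃(x), π̃(x^{(r)})}`. [ours] -/
theorem acceptance_spectralGap_le [Nontrivial S] (hm : 1 ≤ m) (he : ∀ r, (e r).1 ≠ (e r).2)
    (hμ : ∀ k x, 0 < μ k x) (hμ1 : ∀ k, ∑ u, μ k u = 1) (hM : ∀ k, IsRowStochastic (M k))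
    (hMrev : ∀ k, DetailedBalance (μ k) (M k)) (hw0 : ∀ k, 0 ≤ w k) (hw1 : ∑ k, w k = 1) (ht0 : 0 ≤ t)
    (ht1 : t ≤ 1) {A : Finset S} (hφA : ∀ r u, φ r u ∈ A ↔ u ∈ A) (k : Fin (K + 1))
    (hAk : 0 < (∑ u ∈ A, μ k u) * ∑ u ∈ Aᶜ, μ k u) (hidle : w k * edgeMeasure (μ k) (M k) A Aᶜ = 0) :
    spectralGap (tensorFun μ) (fun x y : Fin (K + 1) → S => t * ptGraphSwap μ e φ x y + (1 - t) * prodKernel w M x y)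
      ≤ t * (∑ r ∈ univ.filter (fun r : Fin m => (e r).1 = k ∨ (e r).2 = k),
              ∑ x : Fin (K + 1) → S, min (tensorFun μ x) (tensorFun μ (edgeFlowSwap (φ r) (e r).1 (e r).2 x)))
          / (2 * m * ((∑ u ∈ A, μ k u) * ∑ u ∈ Aᶜ, μ k u)) := by
  have hmpos : (0 : ℝ) < m := Nat.cast_pos.mpr (by omega)
  set a : Fin (K + 1) → ℝ := fun i => if i = k then (1 : ℝ) else 0 with ha
  set G : (Fin (K + 1) → S) → ℝ := fun x => ∑ i, a i * bottleneckTestFun (μ i) A (x i) with hG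
  have hQ := ptGraphSwap_isRowStochastic (e := e) (φ := φ) hμ
  have hQrev := ptGraphSwap_detailedBalance (e := e) (φ := φ) hμ
  have hP := weightedScheme_isRowStochastic (t := t) (w := w) hQ hM hw0 hw1 ht0 ht1
  have hDB := weightedScheme_detailedBalance (w := w) hQrev hMrev t
  have hden : ∑ i, a i ^ 2 * ((∑ u ∈ A, μ i u) * ∑ u ∈ Aᶜ, μ i u) = (∑ u ∈ A, μ k u) * ∑ u ∈ Aᶜ, μ k u := by
    simp_rw [ha, ite_pow, one_pow, zero_pow two_ne_zero, ite_mul, one_mul, zero_mul]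
    rw [Finset.sum_ite_eq' univ k, if_pos (mem_univ _)]
  have hupd : ∑ i, w i * (a i ^ 2 * edgeMeasure (μ i) (M i) A Aᶜ) = 0 := by
    simp_rw [ha, ite_pow, one_pow, zero_pow two_ne_zero, ite_mul, one_mul, zero_mul, mul_ite, mul_zero]
    rw [Finset.sum_ite_eq' univ k, if_pos (mem_univ _)]; exact hidle
  have hray := LevinPeres2017_lemma_13_7_rayleigh (tensorFun_pos hμ) (sum_tensorFun_eq_one μ hμ1) hP hDB
    (ptBare_mean_profileCount (μ := μ) hμ1 a A)
  rw [ptBare_piInner_profileCount hμ1 a A, weightedScheme_dirichletForm (Q := ptGraphSwap μ e φ) (w := w) (M := M),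
    prodKernel_dirichletForm_profileCount hμ1 hM hMrev w a A, hden, hupd, mul_zero, add_zero] at hray
  -- the acceptance-weighted swap form of the single-level profile
  have hsw := ptGraph_dirichletForm_swap_le_acc (e := e) (φ := φ) hμ he G
  have hak : ∀ i, a i = if i = k then (1 : ℝ) else 0 := fun i => by rw [ha]
  have hpt : ∀ (r : Fin m) (x : Fin (K + 1) → S),
      min (tensorFun μ x) (tensorFun μ (edgeFlowSwap (φ r) (e r).1 (e r).2 x))
          * (G x - G (edgeFlowSwap (φ r) (e r).1 (e r).2 x)) ^ 2
        ≤ if (e r).1 = k ∨ (e r).2 = k then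
            min (tensorFun μ x) (tensorFun μ (edgeFlowSwap (φ r) (e r).1 (e r).2 x)) else 0 := by
    intro r x
    have hmin0 : 0 ≤ min (tensorFun μ x) (tensorFun μ (edgeFlowSwap (φ r) (e r).1 (e r).2 x)) :=
      le_min (tensorFun_pos hμ _).le (tensorFun_pos hμ _).le
    rw [hG]
    simp only
    rw [graphProfileCount_sub_swap hμ1 a (hφA r) (he r) x]
    have hsq : ((if x (e r).1 ∈ A then (0 : ℝ) else 1) - (if x (e r).2 ∈ A then (0 : ℝ) else 1)) ^ 2 ≤ 1 := by
      split_ifs <;> norm_num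
    have hsq0 : 0 ≤ ((if x (e r).1 ∈ A then (0 : ℝ) else 1) - (if x (e r).2 ∈ A then (0 : ℝ) else 1)) ^ 2 :=
      sq_nonneg _
    by_cases h1 : (e r).1 = k
    · have h2 : (e r).2 ≠ k := fun h2 => he r (h1.trans h2.symm)
      rw [if_pos (Or.inl h1), hak, hak, if_pos h1, if_neg h2]; nlinarith
    · by_cases h2 : (e r).2 = k
      · rw [if_pos (Or.inr h2), hak, hak, if_neg h1, if_pos h2]; nlinarith
      · rw [if_neg (not_or.mpr ⟨h1, h2⟩), hak, hak, if_neg h1, if_neg h2]; nlinarith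
  have hsum : ∑ r : Fin m, ∑ x : Fin (K + 1) → S,
        min (tensorFun μ x) (tensorFun μ (edgeFlowSwap (φ r) (e r).1 (e r).2 x))
          * (G x - G (edgeFlowSwap (φ r) (e r).1 (e r).2 x)) ^ 2
      ≤ ∑ r ∈ univ.filter (fun r : Fin m => (e r).1 = k ∨ (e r).2 = k),
          ∑ x : Fin (K + 1) → S, min (tensorFun μ x) (tensorFun μ (edgeFlowSwap (φ r) (e r).1 (e r).2 x)) := by
    rw [← Finset.sum_filter_add_sum_filter_not univ (fun r : Fin m => (e r).1 = k ∨ (e r).2 = k)]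
    have hin : ∀ r ∈ univ.filter (fun r : Fin m => (e r).1 = k ∨ (e r).2 = k),
        ∑ x : Fin (K + 1) → S, min (tensorFun μ x) (tensorFun μ (edgeFlowSwap (φ r) (e r).1 (e r).2 x))
            * (G x - G (edgeFlowSwap (φ r) (e r).1 (e r).2 x)) ^ 2
          ≤ ∑ x : Fin (K + 1) → S, min (tensorFun μ x) (tensorFun μ (edgeFlowSwap (φ r) (e r).1 (e r).2 x)) := by
      intro r hr
      have hr' := (Finset.mem_filter.mp hr).2
      refine sum_le_sum fun x _ => ?_
      have := hpt r x
      rw [if_pos hr'] at this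
      exact this
    have hout : ∑ r ∈ univ.filter (fun r : Fin m => ¬((e r).1 = k ∨ (e r).2 = k)),
        ∑ x : Fin (K + 1) → S, min (tensorFun μ x) (tensorFun μ (edgeFlowSwap (φ r) (e r).1 (e r).2 x))
            * (G x - G (edgeFlowSwap (φ r) (e r).1 (e r).2 x)) ^ 2 ≤ 0 := by
      refine Finset.sum_nonpos fun r hr => ?_
      have hr' := (Finset.mem_filter.mp hr).2
      refine Finset.sum_nonpos fun x _ => ?_
      have := hpt r x
      rw [if_neg hr'] at this
      exact this
    linarith [sum_le_sum hin]
  rw [le_div_iff₀ (by positivity)]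
  calc spectralGap (tensorFun μ) (fun x y : Fin (K + 1) → S =>
          t * ptGraphSwap μ e φ x y + (1 - t) * prodKernel w M x y) * (2 * m * ((∑ u ∈ A, μ k u) * ∑ u ∈ Aᶜ, μ k u))
      = 2 * m * (spectralGap (tensorFun μ) (fun x y : Fin (K + 1) → S =>
          t * ptGraphSwap μ e φ x y + (1 - t) * prodKernel w M x y) * ((∑ u ∈ A, μ k u) * ∑ u ∈ Aᶜ, μ k u)) := by
        ring
    _ ≤ 2 * m * (t * dirichletForm (tensorFun μ) (ptGraphSwap μ e φ) G) :=
        mul_le_mul_of_nonneg_left hray (by positivity)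
    _ ≤ 2 * m * (t * (1 / (2 * m) * ∑ r ∈ univ.filter (fun r : Fin m => (e r).1 = k ∨ (e r).2 = k),
          ∑ x : Fin (K + 1) → S, min (tensorFun μ x) (tensorFun μ (edgeFlowSwap (φ r) (e r).1 (e r).2 x)))) := by
        have h := hsw.trans (mul_le_mul_of_nonneg_left hsum (by positivity))
        exact mul_le_mul_of_nonneg_left (mul_le_mul_of_nonneg_left h ht0) (by positivity)
    _ = _ := by field_simp

/-! ## §4 One-sided domination on a hub entry floors its acceptance -/

/-- **ON A HUB ENTRY `(0, k+1)` WITH MAP `φ`, TRANSPORTED DOMINATION `p·μ_{k+1}(φu) ≤ μ_0(u)` GIVES `α ≥ p`:**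
`p ≤ Σ_x min{π̃(x), π̃(edgeFlowSwap φ 0 (k+1) x)}`. [ours] -/
theorem hubEdge_acceptance_ge (hμ : ∀ k u, 0 < μ k u) (hμ1 : ∀ k, ∑ u, μ k u = 1) (ψ : Equiv.Perm S) (k : Fin K)
    {p : ℝ} (hdom : ∀ u, p * μ k.succ (ψ u) ≤ μ 0 u) :
    p ≤ ∑ x : Fin (K + 1) → S, min (tensorFun μ x) (tensorFun μ (edgeFlowSwap ψ 0 k.succ x)) := by
  rw [edgeAcceptance_eq_twoLevel hμ hμ1 ψ (Fin.succ_ne_zero k).symm]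
  exact flowPair_acceptance_ge_oneSided (fun u => (hμ k.succ u).le) (hμ1 k.succ) ψ hdom

end Summit.Ventures.LatticeQCDFlow.Scaling

end
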